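import Summits.QuantumAdvantage.QuantumAdvantage.Theorems.WhiteBoxWalkWbwVerifiableLineNoSpeedupCycleSurgeryDefs

/-!
# Tightness of the per-cut good-set count of line `cycle-surgery-adversary`
(crux `WhiteBoxWalk.WbwVerifiableLineNoSpeedup`, stmt-QuantumAdvantage-2239; drefute g2 negative lemmas)

The lead's registered stub `stub_goodSetCard` (skeleton c5c380df36c1) reads
`∀ m T S k b, 4 ≤ m → 1 ≤ T → T + 1 ≤ 2^(m-1) → InFamily m T S → pre m T ≤ k → k < T →
   2^(m-3) ≤ |mergeGood m T S k b| + |splitGood m T S k b|`.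
Closed form (drefute g2, brute-force validated): `|mergeGood| + |splitGood| =
2^(m-1) - #{j ≤ min (T + hid) (srcPeriod S - 1) : x_j ≡ b}`, independent of `k`; its minimum over
the family is `2^(m-1) - prefix_b(pre) - 2·hid` (all `2·hid` free line positions `pre+1 … T+hid` of
parity `b`, which requires `b =` the sink parity), `= 2^(m-3)` EXACTLY at `m = 4`, `T = 7`, `b = false`.
This file kernel-checks:
* `goodSetCard_tight` — the bound is ATTAINED (`= 2^(m-3)`) at `m = 4, T = 7, k = 6, b = false` by the
  `16`-cycle `0→1→2→3→4→5→6→8→10→7→9→11→12→13→14→15→0` (a family member with even sink `x_7 = 8`);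
  hence the natural strengthening `2^(m-3) + 1 ≤ …` is false (`not_goodSetCard_succ`);
* `goodSetCard_false_of_three_le` — the hypothesis `4 ≤ m` is load-bearing: with `3 ≤ m` the
  statement fails at `m = 3, T = 3, k = 2, b = false` (`8`-cycle `0→1→2→4→6→3→5→7→0`, count `0 < 1`);
* `goodSetCard_false_without_Tbound` — the hypothesis `T + 1 ≤ 2^(m-1)` is load-bearing: at
  `m = 4, T = 9` (`k = 8`, `b = false`, `16`-cycle `0→1→⋯→8→10→12→9→11→13→14→15→0`) the count is `1 < 2`.
(For the parity the degree bound actually consumes, `b ≠` sink parity, the minimum is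
`2^(m-1) - prefix_b(pre) - (2·hid - 1) ≥ 2^(m-3) + 1`; see the drefute g2 report on the item.)
No statement of the route is asserted here.
-/

set_option linter.dupNamespace false

namespace Summit.QuantumAdvantage.QuantumAdvantage.Theorems.WbwVerifiableLineNoSpeedup.CycleSurgery.DrefuteG2

open Function

/-! ## Witness 1: `m = 4`, `T = 7` — the bound `2^(m-3) = 2` is attained -/

/-- The `16`-cycle `0→1→2→3→4→5→6→8→10→7→9→11→12→13→14→15→0` on `Fin (2^4)`. -/
def w47 : Equiv.Perm (Fin (2 ^ 4)) where
  toFun := ![1, 2, 3, 4, 5, 6, 8, 9, 10, 11, 7, 12, 13, 14, 15, 0]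
  invFun := ![15, 0, 1, 2, 3, 4, 5, 10, 6, 7, 8, 9, 11, 12, 13, 14]
  left_inv := by decide
  right_inv := by decide

/-- `w47` is a family member at `m = 4, T = 7` (prefix `0..6` pinned, line simple, no fixed point). -/
theorem w47_inFamily : InFamily 4 7 w47 := by
  refine ⟨by decide, by decide, ?_⟩
  intro x j hj hj1
  have hj' : j = 1 := by
    have : hid 4 7 = 1 := by decide
    omega
  subst hj'
  revert x
  decide

/-- Its sink `x_7 = 8` is even. -/
theorem w47_sinkOdd : sinkOdd 4 7 w47 = false := by decide

/-- `w47` is a single `16`-cycle: no name is off the source cycle. -/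
theorem w47_not_offCycle (v : Fin (2 ^ 4)) : ¬ OffCycle w47 v := by
  have key : ∀ v : Fin (2 ^ 4), ∃ j : Fin 16, pt w47 j.val = v := by decide
  intro h
  obtain ⟨j, hj⟩ := key v
  exact h j.val hj

/-- Hence `w47` has no merge partners at all. -/
theorem w47_mergeGood (k : ℕ) (b : Bool) : mergeGood 4 7 w47 k b = ∅ := by
  ext v
  simp only [Finset.notMem_empty, iff_false]
  intro hv
  exact w47_not_offCycle v (mem_mergeGood.1 hv).1

/-- The source period of `w47` is `16`. -/
theorem w47_srcPeriod : srcPeriod w47 = 16 := by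
  have h8 : ¬ IsPeriodicPt w47 (2 ^ 3) (src 4) := by decide
  have h16 : IsPeriodicPt w47 (2 ^ (3 + 1)) (src 4) := by decide
  have := minimalPeriod_eq_prime_pow h8 h16
  simpa [srcPeriod] using this

/-- The far-split positions of `w47` at cut `6` with even new sink are exactly `q = 11, 13` (`x_12 = 12`, `x_14 = 14`). -/
theorem w47_splitGood : splitGood 4 7 w47 6 false = {11, 13} := by
  ext q
  rw [mem_splitGood, w47_srcPeriod]
  simp only [Finset.mem_insert, Finset.mem_singleton]
  have hhid : hid 4 7 = 1 := by decide
  rw [hhid]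
  constructor
  · rintro ⟨h1, h2, h3⟩
    have hq : q < 15 := by omega
    have hq' : 7 < q := by omega
    interval_cases q <;> simp_all <;> revert h3 <;> decide
  · rintro (rfl | rfl) <;> refine ⟨by norm_num, by norm_num, by decide⟩

/-- **Tightness.** At `m = 4, T = 7, k = 6 (= pre), b = false` the family member `w47` has EXACTLY
`2^(m-3) = 2` good partners of sink parity `false` at the cut: the bound of `stub_goodSetCard`
cannot be improved. -/
theorem goodSetCard_tight :
    4 ≤ 4 ∧ 1 ≤ 7 ∧ 7 + 1 ≤ 2 ^ (4 - 1) ∧ InFamily 4 7 w47 ∧ pre 4 7 ≤ 6 ∧ 6 < 7 ∧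
      (mergeGood 4 7 w47 6 false).card + (splitGood 4 7 w47 6 false).card = 2 ^ (4 - 3) := by
  refine ⟨le_rfl, by norm_num, by norm_num, w47_inFamily, by decide, by norm_num, ?_⟩
  rw [w47_mergeGood, w47_splitGood]
  decide

/-- Hence the natural strengthening of `stub_goodSetCard` by one is FALSE. -/
theorem not_goodSetCard_succ :
    ¬ (∀ (m T : ℕ) (S : Equiv.Perm (Fin (2 ^ m))) (k : ℕ) (b : Bool), 4 ≤ m → 1 ≤ T →
        T + 1 ≤ 2 ^ (m - 1) → InFamily m T S → pre m T ≤ k → k < T →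
          2 ^ (m - 3) + 1 ≤ (mergeGood m T S k b).card + (splitGood m T S k b).card) := by
  intro h
  obtain ⟨h1, h2, h3, h4, h5, h6, h7⟩ := goodSetCard_tight
  have := h 4 7 w47 6 false h1 h2 h3 h4 h5 h6
  omega

/-! ## Witness 2: `m = 3`, `T = 3` — `4 ≤ m` cannot be weakened to `3 ≤ m` -/

/-- The `8`-cycle `0→1→2→4→6→3→5→7→0` on `Fin (2^3)`. -/
def w33 : Equiv.Perm (Fin (2 ^ 3)) where
  toFun := ![1, 2, 4, 5, 6, 7, 3, 0]
  invFun := ![7, 0, 1, 6, 2, 3, 4, 5]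
  left_inv := by decide
  right_inv := by decide

/-- `w33` is a family member at `m = 3, T = 3` (prefix `0..2` pinned, line simple, no fixed point). -/
theorem w33_inFamily : InFamily 3 3 w33 := by
  refine ⟨by decide, by decide, ?_⟩
  intro x j hj hj1
  have hj' : j = 1 := by
    have : hid 3 3 = 1 := by decide
    omega
  subst hj'
  revert x
  decide

/-- `w33` is a single `8`-cycle: no name is off the source cycle. -/
theorem w33_not_offCycle (v : Fin (2 ^ 3)) : ¬ OffCycle w33 v := by
  have key : ∀ v : Fin (2 ^ 3), ∃ j : Fin 8, pt w33 j.val = v := by decide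
  intro h
  obtain ⟨j, hj⟩ := key v
  exact h j.val hj

/-- Hence `w33` has no merge partners at all. -/
theorem w33_mergeGood (k : ℕ) (b : Bool) : mergeGood 3 3 w33 k b = ∅ := by
  ext v
  simp only [Finset.notMem_empty, iff_false]
  intro hv
  exact w33_not_offCycle v (mem_mergeGood.1 hv).1

/-- The source period of `w33` is `8`. -/
theorem w33_srcPeriod : srcPeriod w33 = 8 := by
  have h4 : ¬ IsPeriodicPt w33 (2 ^ 2) (src 3) := by decide
  have h8 : IsPeriodicPt w33 (2 ^ (2 + 1)) (src 3) := by decide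
  have := minimalPeriod_eq_prime_pow h4 h8
  simpa [srcPeriod] using this

/-- `w33` has no far-split position at cut `2` with even new sink (`x_5, x_6, x_7 = 3, 5, 7` are odd). -/
theorem w33_splitGood : splitGood 3 3 w33 2 false = ∅ := by
  ext q
  rw [mem_splitGood, w33_srcPeriod]
  simp only [Finset.notMem_empty, iff_false]
  have hhid : hid 3 3 = 1 := by decide
  rw [hhid]
  rintro ⟨h1, h2, h3⟩
  have hq : q < 7 := by omega
  have hq' : 3 < q := by omega
  interval_cases q <;> revert h3 <;> decide

/-- **`4 ≤ m` is load-bearing in `stub_goodSetCard`:** the same statement with `3 ≤ m` is false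
(witness `m = 3, T = 3, k = 2, b = false`: no good partner of even sink parity at all). -/
theorem goodSetCard_false_of_three_le :
    ¬ (∀ (m T : ℕ) (S : Equiv.Perm (Fin (2 ^ m))) (k : ℕ) (b : Bool), 3 ≤ m → 1 ≤ T →
        T + 1 ≤ 2 ^ (m - 1) → InFamily m T S → pre m T ≤ k → k < T →
          2 ^ (m - 3) ≤ (mergeGood m T S k b).card + (splitGood m T S k b).card) := by
  intro h
  have := h 3 3 w33 2 false le_rfl (by norm_num) (by norm_num) w33_inFamily (by decide) (by norm_num)
  rw [w33_mergeGood, w33_splitGood] at this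
  simp at this

/-! ## Witness 3: `m = 4`, `T = 9` — `T + 1 ≤ 2^(m-1)` is load-bearing -/

/-- The `16`-cycle `0→1→⋯→8→10→12→9→11→13→14→15→0` on `Fin (2^4)`. -/
def w49 : Equiv.Perm (Fin (2 ^ 4)) where
  toFun := ![1, 2, 3, 4, 5, 6, 7, 8, 10, 11, 12, 13, 9, 14, 15, 0]
  invFun := ![15, 0, 1, 2, 3, 4, 5, 6, 7, 12, 8, 9, 10, 11, 13, 14]
  left_inv := by decide
  right_inv := by decide

/-- `w49` is a family member at `m = 4, T = 9` (prefix `0..8` pinned, line simple, no fixed point). -/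
theorem w49_inFamily : InFamily 4 9 w49 := by
  refine ⟨by decide, by decide, ?_⟩
  intro x j hj hj1
  have hj' : j = 1 := by
    have : hid 4 9 = 1 := by decide
    omega
  subst hj'
  revert x
  decide

/-- `w49` is a single `16`-cycle: no name is off the source cycle. -/
theorem w49_not_offCycle (v : Fin (2 ^ 4)) : ¬ OffCycle w49 v := by
  have key : ∀ v : Fin (2 ^ 4), ∃ j : Fin 16, pt w49 j.val = v := by decide
  intro h
  obtain ⟨j, hj⟩ := key v
  exact h j.val hj

/-- Hence `w49` has no merge partners at all. -/
theorem w49_mergeGood (k : ℕ) (b : Bool) : mergeGood 4 9 w49 k b = ∅ := by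
  ext v
  simp only [Finset.notMem_empty, iff_false]
  intro hv
  exact w49_not_offCycle v (mem_mergeGood.1 hv).1

/-- The source period of `w49` is `16`. -/
theorem w49_srcPeriod : srcPeriod w49 = 16 := by
  have h8 : ¬ IsPeriodicPt w49 (2 ^ 3) (src 4) := by decide
  have h16 : IsPeriodicPt w49 (2 ^ (3 + 1)) (src 4) := by decide
  have := minimalPeriod_eq_prime_pow h8 h16
  simpa [srcPeriod] using this

/-- The only far-split position of `w49` at cut `8` with even new sink is `q = 13` (`x_14 = 14`). -/
theorem w49_splitGood : splitGood 4 9 w49 8 false = {13} := by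
  ext q
  rw [mem_splitGood, w49_srcPeriod]
  simp only [Finset.mem_singleton]
  have hhid : hid 4 9 = 1 := by decide
  rw [hhid]
  constructor
  · rintro ⟨h1, h2, h3⟩
    have hq : q < 15 := by omega
    have hq' : 9 < q := by omega
    interval_cases q <;> simp_all <;> revert h3 <;> decide
  · rintro rfl; refine ⟨by norm_num, by norm_num, by decide⟩

/-- **`T + 1 ≤ 2^(m-1)` is load-bearing in `stub_goodSetCard`:** dropping it, the statement fails
at `m = 4, T = 9` (`k = 8, b = false`: one good partner, `1 < 2 = 2^(m-3)`). (By exhaustive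
enumeration it still holds at `T = 8`: one step of slack at `m = 4`.) -/
theorem goodSetCard_false_without_Tbound :
    ¬ (∀ (m T : ℕ) (S : Equiv.Perm (Fin (2 ^ m))) (k : ℕ) (b : Bool), 4 ≤ m → 1 ≤ T →
        InFamily m T S → pre m T ≤ k → k < T →
          2 ^ (m - 3) ≤ (mergeGood m T S k b).card + (splitGood m T S k b).card) := by
  intro h
  have := h 4 9 w49 8 false le_rfl (by norm_num) w49_inFamily (by decide) (by norm_num)
  rw [w49_mergeGood, w49_splitGood] at this
  simp at this

end Summit.QuantumAdvantage.QuantumAdvantage.Theorems.WbwVerifiableLineNoSpeedup.CycleSurgery.DrefuteG2
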